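import Summits.ABC.IUTFork.Repair.RHSigmaCellCreditAbcExp
import Summits.ABC.IUTFork.Repair.RHSigmaMassGap
import HarnessLib

/-!
# D-0121 Q1 / ROUND 3: the WEIGHTED (netted) door to the abc sentences, with [MU] in KEPT-MASS form — «ω ≤ 1, PN Σ ω·d ≤ 0, kept ω-mass
# ≥ μ₀·T.gap − Tol on the content locus ∧ hregC ⟹ c < C_ε·rad(abc)^{3/μ₀+ε} (all triples) and abc with exponent 1/μ₀ on every far-from-cusps family»

abc-iut cell, rung LADDER-ABC:A2.RESCUE.H, R-H seat abc-iut-rh2-q2-eq (gen 3; owner of THE WEIGHTED DOOR p480491). PROOF-ONLY file (0 definitions, 0 `Prop`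
facts, no instance, no notation): the weighted (aggregate, NETTING) twins that `RHSigmaCellCreditAbcExp.lean` (p486022) left as «one-line substitutions», now
spelled out because D0121-SPEC v0 §1.2 (topt-pv-3 «GLUE into MIN-SLICE / EXP», file `Conditional/AbcExpOfSigmaMassFinanced.lean`) wants exactly the sentence
«[W-C](ω) ∧ kept ω-mass ≥ μ_fin·gap − Tol ∧ [CONE-C] ⟹ ABCWithExponentOn far-from-cusps (1/μ_fin)» as ONE named theorem with the LP-2 value `μ_fin` for `μ₀`:
topt-pv-3's file is then a λ-term over §2 below (choose `μ₀ := μ_fin`), or cites it. Composed BY NAME from p484564 (`cor312UpTo_weightedTrivialMass_of_weightedDeficit_nonpos_chosen`),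
p484504 (`weightedTrivialMass_le_iff_keptMass_ge`), abc-iut-rh2-w-1's p478601 (`CellWeights.totalTrivialMass_chosen_eq_gap`: `M = T.gap` at the chosen bed) and
abc-iut-rh2-q2-cond's degree-one ε-doors p484277 / p484796.

WHAT IS TYPED (`0 < μ₀ ≤ 1`; `Tol(P,l) = Conditional.SigmaMass.tol P l`; CHOSEN realising ideles; datum-dependent weight `ω P l T`; content locus of abc-iut-C-cert-1):
* §1 `offSigmaTolerance_weightedTrivialMass_iff_keptMass_ge_chosen` — AT THE DATUM the charged-mass binder [MU-ω] `OffSigmaTolerance (1−μ₀) A T (PN Σᶠ(1−ω)·t)`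
  IS the kept-mass inequality `μ₀·T.gap − A ≤ PN Σᶠ ω·t` (`M = T.gap`).
* §2 **`abc_exp_three_div_of_weightedDeficit_nonpos_keptMass_content_hregC`** — explicit 3 = [W-C] «`ω ≤ 1` ∧ `weightedDeficit … ω ≤ 0`» · [KEPT-C]
  «`μ₀·T.gap − Tol(P,l) ≤ PN Σᶠ ω·t`» · [CONE-C] `hregC` VERBATIM, each ONLY on the content locus ⟹ `∀ ε' > 0, ∃ C > 0, c < C·rad(abc)^{3/μ₀+ε'}` for EVERY
  abc triple; **`ABCExpOn_farFromCusps_of_weightedDeficit_nonpos_keptMass_content_hregC_degOne`** — the same three binders ⟹ for every `0 < ρ ≤ 1/2`,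
  `GenEll.ABCWithExponentOn {P | P.FarFromCusps {2} ρ} (1/μ₀)` = D0121-SPEC §1.2 topt-pv-3's sentence with `μ_fin ↦ μ₀` a free parameter.
HONEST FRAMING: CONDITIONAL; «the abc-type inequalities follow from these hypotheses AS TYPED», nothing more; [W-C] / [KEPT-C] / [CONE-C] are ASSUMPTION LABELS,
never asserted for any datum or scheme; whether a netted scheme with kept mass `≥ μ_fin·gap − Tol` exists on the content locus is what the LP seats TABULATE on the
certified bed (computed ≠ proved) and is OPEN beyond it; nothing here asserts that abc (with any exponent) is proved or refuted, or that [IUTchIII] Cor. 3.12 /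
[IUTchIV] Thm. 1.10 holds or fails at any datum, or takes a side on any author; typed ≠ proved; instantiated ≠ endorsed. [claim: Mochizuki2012, status: disputed]
[cite: Mochizuki2012, IUTchIII Cor. 3.12 p. 173–174, Prop. 3.9 (i) p. 116; IUTchIV Thm. 1.10 pp. 22–31 (p. 23, Step (viii) p. 30), Cor. 2.2 (ii)–(iii) pp. 41–48]
[cite: MochizukiGenEll2010, Thm 2.1 p.12]
-/

noncomputable section

open Set Function NumberField IsDedekindDomain

namespace Summit.ABC.IUTFork.Repair.RH.SigmaStrataEq

open Summit.ABC.IUTFork.Thm311 Summit.ABC.IUTFork.Thm311.Real Summit.ABC.IUTFork.Cor312 Summit.ABC.IUTFork.Cor312.Setting Summit.ABC.IUTFork.Cor312Vol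
  Summit.ABC.IUTFork.Cor312Prov Literature.IUT.LogThetaLattice Literature.IUT.LogVolume Literature.IUT.HodgeTheaters Literature.IUT.LogVolume.ThetaData
  Literature.NumberTheory.DiophantineGeometry Literature.NumberTheory.DiophantineGeometry.GenEll Summit.ABC.ABC.Theorems
  Summit.ABC.IUTFork.Repair.RH.SigmaLicence Summit.ABC.IUTFork.Repair.RH.SigmaMass Summit.ABC.IUTFork.Conditional

/-! ## §1. At the datum: the charged-mass binder IS the kept-mass inequality (`M = T.gap`) -/

section Datum

/-- **[MU-ω] in kept-mass form at the chosen bed**: for every genuine Θ-volume datum `T`, every context, every weight `ω` and all reals `μ₀, A`: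
`RH.OffSigma.OffSigmaTolerance (1 − μ₀) A T (weightedTrivialMass … ω)` (charged mass `≤ (1−μ₀)·T.gap + A`) `⟺ μ₀·T.gap − A ≤ weightedTrivialMass … (1 − ω)`
(kept mass) — p484504 `weightedTrivialMass_le_iff_keptMass_ge` with abc-iut-rh2-w-1's `totalTrivialMass_chosen_eq_gap`. [claim: Mochizuki2012, status: disputed] -/
theorem offSigmaTolerance_weightedTrivialMass_iff_keptMass_ge_chosen {P : NFPoint} {l : ℕ} (T : Cor22.ThetaVolumeDatumAt P l) :
    letI := T.instFieldF; letI := T.instNumberFieldF; letI := T.instAlgebraF; letI := T.instFieldK;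
        letI := T.instNumberFieldK; letI := T.instAlgebraK; letI := T.instFieldFbar; letI := T.instAlgebraFbar;
        letI := T.instAlgebraKFbar; letI := T.instIsElliptic;
    ∀ (M : Type) [Field M] [NumberField M]
      (archPk : ∀ (j : (thetaIndex (pilotDataOfK T.D T.K)).Label) (vQ : (thetaIndex (pilotDataOfK T.D T.K)).VQ),
        Set ((logShellsDH (pilotDataOfK T.D T.K) (analyticLogv T.K)).Packet j vQ))
      (archSub : ∀ (j : (thetaIndex (pilotDataOfK T.D T.K)).Label) (v : (thetaIndex (pilotDataOfK T.D T.K)).V),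
        Set ((logShellsDH (pilotDataOfK T.D T.K) (analyticLogv T.K)).Packet j ((thetaIndex (pilotDataOfK T.D T.K)).over v)))
      (Ψ : ℤ → ∀ v : (thetaIndex (pilotDataOfK T.D T.K)).V, v ∈ (thetaIndex (pilotDataOfK T.D T.K)).Vbad →
        Set ((logShellsDH (pilotDataOfK T.D T.K) (analyticLogv T.K)).StarPacket v))
      (act : ℤ → ∀ v : (thetaIndex (pilotDataOfK T.D T.K)).V, v ∈ (thetaIndex (pilotDataOfK T.D T.K)).Vbad →
        (logShellsDH (pilotDataOfK T.D T.K) (analyticLogv T.K)).StarPacket v →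
          Module.End ℚ ((logShellsDH (pilotDataOfK T.D T.K) (analyticLogv T.K)).StarPacket v))
      (Mmod : ℤ → ∀ j : (thetaIndex (pilotDataOfK T.D T.K)).LabelStar,
        Set ((logShellsDH (pilotDataOfK T.D T.K) (analyticLogv T.K)).GlobalPacket j.1))
      (region : ℤ → ∀ j : (thetaIndex (pilotDataOfK T.D T.K)).LabelStar, FinDivisor M →
        ∀ vQ : (thetaIndex (pilotDataOfK T.D T.K)).VQ, Set ((logShellsDH (pilotDataOfK T.D T.K) (analyticLogv T.K)).Packet j.1 vQ))
      (n : ℤ) {HT : Type} {LogLink : HT → HT → Type} {IsFull : ∀ {s t : HT}, LogLink s t → Prop}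
      (lat : LGPGaussianLogThetaLattice LogLink IsFull)
      {Frd : Type} {IsoF : Frd → Frd → Type} {Ob : Frd → Type} {realify : Frd → Frd} {Strip : Type}
      {IsoS : Strip → Strip → Type}
      {Mv : ∀ v : (thetaIndex (pilotDataOfK T.D T.K)).V, v ∈ (thetaIndex (pilotDataOfK T.D T.K)).Vbad → Type}
      [∀ v h, Monoid (Mv v h)]
      (sig : GlobalLGPFrobenioidSignature (thetaIndex (pilotDataOfK T.D T.K)).lstar (thetaIndex (pilotDataOfK T.D T.K)).V
        (· ∈ (thetaIndex (pilotDataOfK T.D T.K)).Vbad) Frd IsoF Ob realify Strip IsoS Mv)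
      (split : SplittingMonoids Mv) {ObΔ : Type}
      {N : ∀ v : (thetaIndex (pilotDataOfK T.D T.K)).V, v ∈ (thetaIndex (pilotDataOfK T.D T.K)).Vbad → Type} [∀ v h, Monoid (N v h)]
      (qData : QPilotData ObΔ N)
      (ω : Fin (thetaIndex (pilotDataOfK T.D T.K)).lstar × (thetaIndex (pilotDataOfK T.D T.K)).VQ → ℝ) (μ₀ A : ℝ),
      RH.OffSigma.OffSigmaTolerance (1 - μ₀) A T
          (weightedTrivialMass (settingPrVolSharp (pilotDataOfK T.D T.K) (logvAnalytic_analyticLogv (F := T.K)) M archPk archSub Ψ act Mmod region n lat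
            sig split qData (exists_realising_qIdeles_pilotDataOfK T.D).choose (exists_realising_thetaIdeles_pilotDataOfK T.D).choose
            (exists_realising_qIdeles_pilotDataOfK T.D).choose_spec.1 (exists_realising_qIdeles_pilotDataOfK T.D).choose_spec.2.1) ω) ↔
        μ₀ * T.gap - A ≤
          weightedTrivialMass (settingPrVolSharp (pilotDataOfK T.D T.K) (logvAnalytic_analyticLogv (F := T.K)) M archPk archSub Ψ act Mmod region n lat
            sig split qData (exists_realising_qIdeles_pilotDataOfK T.D).choose (exists_realising_thetaIdeles_pilotDataOfK T.D).choose
            (exists_realising_qIdeles_pilotDataOfK T.D).choose_spec.1 (exists_realising_qIdeles_pilotDataOfK T.D).choose_spec.2.1) (fun c => 1 - ω c) := by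
  intro M _ _ archPk archSub Ψ act Mmod region n HT LogLink IsFull lat Frd IsoF Ob realify Strip IsoS Mv _ sig split ObΔ N _ qData ω μ₀ A
  letI := T.instFieldF; letI := T.instNumberFieldF; letI := T.instAlgebraF; letI := T.instFieldK
  letI := T.instNumberFieldK; letI := T.instAlgebraK; letI := T.instFieldFbar; letI := T.instAlgebraFbar
  letI := T.instAlgebraKFbar; letI := T.instIsElliptic
  have H := bridgeHyps_settingPrVolSharp_of_ideles (pilotDataOfK T.D T.K) (logvAnalytic_analyticLogv (F := T.K)) M archPk archSub Ψ act
    Mmod region n lat sig split qData (exists_realising_thetaIdeles_pilotDataOfK T.D).choose (exists_realising_qIdeles_pilotDataOfK T.D).choose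
    (exists_realising_thetaIdeles_pilotDataOfK T.D).choose_spec.1 (exists_realising_thetaIdeles_pilotDataOfK T.D).choose_spec.2.1
    (exists_realising_qIdeles_pilotDataOfK T.D).choose_spec.1 (exists_realising_qIdeles_pilotDataOfK T.D).choose_spec.2.1
  have hM := Summit.ABC.IUTFork.Repair.RH.CellWeights.totalTrivialMass_chosen_eq_gap T M archPk archSub Ψ act Mmod region n lat sig split qData
  unfold RH.OffSigma.OffSigmaTolerance
  rw [← hM, weightedTrivialMass_le_iff_keptMass_ge H ω (1 - μ₀) A, sub_sub_cancel]

end Datum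

/-! ## §2. The weighted door to the abc sentences (degree one), [MU] in kept-mass form -/

section Ends
variable
    (M : ∀ (P : NFPoint) (l : ℕ) (T : Cor22.ThetaVolumeDatumAt P l), Type) [∀ P l T, Field (M P l T)] [∀ P l T, NumberField (M P l T)]
    (archPk : ∀ (P : NFPoint) (l : ℕ) (T : Cor22.ThetaVolumeDatumAt P l), letI := T.instFieldF; letI := T.instNumberFieldF; letI := T.instAlgebraF; letI := T.instFieldK;
        letI := T.instNumberFieldK; letI := T.instAlgebraK; letI := T.instFieldFbar; letI := T.instAlgebraFbar;
        letI := T.instAlgebraKFbar; letI := T.instIsElliptic;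
      ∀ (j : (thetaIndex (pilotDataOfK T.D T.K)).Label) (vQ : (thetaIndex (pilotDataOfK T.D T.K)).VQ), Set ((logShellsDH (pilotDataOfK T.D T.K) (analyticLogv T.K)).Packet j vQ))
    (archSub : ∀ (P : NFPoint) (l : ℕ) (T : Cor22.ThetaVolumeDatumAt P l), letI := T.instFieldF; letI := T.instNumberFieldF; letI := T.instAlgebraF; letI := T.instFieldK;
        letI := T.instNumberFieldK; letI := T.instAlgebraK; letI := T.instFieldFbar; letI := T.instAlgebraFbar;
        letI := T.instAlgebraKFbar; letI := T.instIsElliptic;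
      ∀ (j : (thetaIndex (pilotDataOfK T.D T.K)).Label) (v : (thetaIndex (pilotDataOfK T.D T.K)).V), Set ((logShellsDH (pilotDataOfK T.D T.K) (analyticLogv T.K)).Packet j ((thetaIndex (pilotDataOfK T.D T.K)).over v)))
    (Ψ : ∀ (P : NFPoint) (l : ℕ) (T : Cor22.ThetaVolumeDatumAt P l), letI := T.instFieldF; letI := T.instNumberFieldF; letI := T.instAlgebraF; letI := T.instFieldK;
        letI := T.instNumberFieldK; letI := T.instAlgebraK; letI := T.instFieldFbar; letI := T.instAlgebraFbar;
        letI := T.instAlgebraKFbar; letI := T.instIsElliptic;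
      ℤ → ∀ v : (thetaIndex (pilotDataOfK T.D T.K)).V, v ∈ (thetaIndex (pilotDataOfK T.D T.K)).Vbad → Set ((logShellsDH (pilotDataOfK T.D T.K) (analyticLogv T.K)).StarPacket v))
    (act : ∀ (P : NFPoint) (l : ℕ) (T : Cor22.ThetaVolumeDatumAt P l), letI := T.instFieldF; letI := T.instNumberFieldF; letI := T.instAlgebraF; letI := T.instFieldK;
        letI := T.instNumberFieldK; letI := T.instAlgebraK; letI := T.instFieldFbar; letI := T.instAlgebraFbar;
        letI := T.instAlgebraKFbar; letI := T.instIsElliptic;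
      ℤ → ∀ v : (thetaIndex (pilotDataOfK T.D T.K)).V, v ∈ (thetaIndex (pilotDataOfK T.D T.K)).Vbad → (logShellsDH (pilotDataOfK T.D T.K) (analyticLogv T.K)).StarPacket v → Module.End ℚ ((logShellsDH (pilotDataOfK T.D T.K) (analyticLogv T.K)).StarPacket v))
    (Mmod : ∀ (P : NFPoint) (l : ℕ) (T : Cor22.ThetaVolumeDatumAt P l), letI := T.instFieldF; letI := T.instNumberFieldF; letI := T.instAlgebraF; letI := T.instFieldK;
        letI := T.instNumberFieldK; letI := T.instAlgebraK; letI := T.instFieldFbar; letI := T.instAlgebraFbar;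
        letI := T.instAlgebraKFbar; letI := T.instIsElliptic;
      ℤ → ∀ j : (thetaIndex (pilotDataOfK T.D T.K)).LabelStar, Set ((logShellsDH (pilotDataOfK T.D T.K) (analyticLogv T.K)).GlobalPacket j.1))
    (region : ∀ (P : NFPoint) (l : ℕ) (T : Cor22.ThetaVolumeDatumAt P l), letI := T.instFieldF; letI := T.instNumberFieldF; letI := T.instAlgebraF; letI := T.instFieldK;
        letI := T.instNumberFieldK; letI := T.instAlgebraK; letI := T.instFieldFbar; letI := T.instAlgebraFbar;
        letI := T.instAlgebraKFbar; letI := T.instIsElliptic;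
      ℤ → ∀ j : (thetaIndex (pilotDataOfK T.D T.K)).LabelStar, FinDivisor (M P l T) → ∀ vQ : (thetaIndex (pilotDataOfK T.D T.K)).VQ, Set ((logShellsDH (pilotDataOfK T.D T.K) (analyticLogv T.K)).Packet j.1 vQ))
    (n : ∀ (P : NFPoint) (l : ℕ) (T : Cor22.ThetaVolumeDatumAt P l), ℤ)
    {HT : ∀ (P : NFPoint) (l : ℕ) (T : Cor22.ThetaVolumeDatumAt P l), Type} {LogLink : ∀ (P : NFPoint) (l : ℕ) (T : Cor22.ThetaVolumeDatumAt P l), HT P l T → HT P l T → Type}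
    {IsFull : ∀ (P : NFPoint) (l : ℕ) (T : Cor22.ThetaVolumeDatumAt P l), ∀ {s t : HT P l T}, LogLink P l T s t → Prop}
    (lat : ∀ (P : NFPoint) (l : ℕ) (T : Cor22.ThetaVolumeDatumAt P l), LGPGaussianLogThetaLattice (LogLink P l T) (IsFull P l T))
    {Frd : ∀ (P : NFPoint) (l : ℕ) (T : Cor22.ThetaVolumeDatumAt P l), Type} {IsoF : ∀ (P : NFPoint) (l : ℕ) (T : Cor22.ThetaVolumeDatumAt P l), Frd P l T → Frd P l T → Type} {Ob : ∀ (P : NFPoint) (l : ℕ) (T : Cor22.ThetaVolumeDatumAt P l), Frd P l T → Type}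
    {realify : ∀ (P : NFPoint) (l : ℕ) (T : Cor22.ThetaVolumeDatumAt P l), Frd P l T → Frd P l T} {Strip : ∀ (P : NFPoint) (l : ℕ) (T : Cor22.ThetaVolumeDatumAt P l), Type} {IsoS : ∀ (P : NFPoint) (l : ℕ) (T : Cor22.ThetaVolumeDatumAt P l), Strip P l T → Strip P l T → Type}
    {Mv : ∀ (P : NFPoint) (l : ℕ) (T : Cor22.ThetaVolumeDatumAt P l), letI := T.instFieldF; letI := T.instNumberFieldF; letI := T.instAlgebraF; letI := T.instFieldK;
        letI := T.instNumberFieldK; letI := T.instAlgebraK; letI := T.instFieldFbar; letI := T.instAlgebraFbar;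
        letI := T.instAlgebraKFbar; letI := T.instIsElliptic;
      ∀ v : (thetaIndex (pilotDataOfK T.D T.K)).V, v ∈ (thetaIndex (pilotDataOfK T.D T.K)).Vbad → Type}
    [∀ P l T v h, Monoid (Mv P l T v h)]
    (sig : ∀ (P : NFPoint) (l : ℕ) (T : Cor22.ThetaVolumeDatumAt P l), letI := T.instFieldF; letI := T.instNumberFieldF; letI := T.instAlgebraF; letI := T.instFieldK;
        letI := T.instNumberFieldK; letI := T.instAlgebraK; letI := T.instFieldFbar; letI := T.instAlgebraFbar;
        letI := T.instAlgebraKFbar; letI := T.instIsElliptic;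
      GlobalLGPFrobenioidSignature (thetaIndex (pilotDataOfK T.D T.K)).lstar (thetaIndex (pilotDataOfK T.D T.K)).V (· ∈ (thetaIndex (pilotDataOfK T.D T.K)).Vbad) (Frd P l T) (IsoF P l T) (Ob P l T) (realify P l T)
        (Strip P l T) (IsoS P l T) (Mv P l T))
    (split : ∀ (P : NFPoint) (l : ℕ) (T : Cor22.ThetaVolumeDatumAt P l), SplittingMonoids (Mv P l T))
    {ObΔ : ∀ (P : NFPoint) (l : ℕ) (T : Cor22.ThetaVolumeDatumAt P l), Type} {N : ∀ (P : NFPoint) (l : ℕ) (T : Cor22.ThetaVolumeDatumAt P l), letI := T.instFieldF; letI := T.instNumberFieldF; letI := T.instAlgebraF; letI := T.instFieldK;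
        letI := T.instNumberFieldK; letI := T.instAlgebraK; letI := T.instFieldFbar; letI := T.instAlgebraFbar;
        letI := T.instAlgebraKFbar; letI := T.instIsElliptic;
      ∀ v : (thetaIndex (pilotDataOfK T.D T.K)).V, v ∈ (thetaIndex (pilotDataOfK T.D T.K)).Vbad → Type}
    [∀ P l T v h, Monoid (N P l T v h)] (qData : ∀ (P : NFPoint) (l : ℕ) (T : Cor22.ThetaVolumeDatumAt P l), QPilotData (ObΔ P l T) (N P l T))

include M archPk archSub Ψ act Mmod region n lat sig split qData

/-- **`abc_exp_three_div_of_weightedDeficit_nonpos_keptMass_content_hregC` — THE WEIGHTED (NETTED) DOOR ⟹ `c < C_ε·rad(abc)^{3/μ₀+ε}` FOR EVERY abc TRIPLE**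
(`0 < μ₀ ≤ 1`). Explicit 3 = [W-C] · [KEPT-C] · [CONE-C] on the content locus ⟹ `∀ ε' > 0, ∃ C > 0, c < C·rad(abc)^{3/μ₀ + ε'}` for all abc triples:
abc-iut-rh2-q2-cond's `Cor312Slack.abc_exp_three_div_of_cor312Slack_mu_content_hregC` with `ε P l T := weightedTrivialMass … (ω P l T)`, [NUMΣ-C] DISCHARGED by
p484564's `cor312UpTo_weightedTrivialMass_of_weightedDeficit_nonpos_chosen`, [MU-C] from [KEPT-C] by §1. CONDITIONAL; nothing asserted about the hypotheses; no
side taken. [cite: Mochizuki2012, IUTchIV Thm. 1.10 pp. 22–31; Cor. 2.2 (ii)–(iii) pp. 41–48; IUTchIII Cor. 3.12 p. 174] [claim: Mochizuki2012, status: disputed] -/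
theorem abc_exp_three_div_of_weightedDeficit_nonpos_keptMass_content_hregC (μ₀ : ℝ) (hμ₀ : 0 < μ₀) (hμ₁ : μ₀ ≤ 1)
    (ω : ∀ (P : NFPoint) (l : ℕ) (T : Cor22.ThetaVolumeDatumAt P l), letI := T.instFieldF; letI := T.instNumberFieldF; letI := T.instAlgebraF; letI := T.instFieldK;
        letI := T.instNumberFieldK; letI := T.instAlgebraK; letI := T.instFieldFbar; letI := T.instAlgebraFbar;
        letI := T.instAlgebraKFbar; letI := T.instIsElliptic;
      Fin (thetaIndex (pilotDataOfK T.D T.K)).lstar × (thetaIndex (pilotDataOfK T.D T.K)).VQ → ℝ)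
    -- [W-C] THE WEIGHTED DOOR's hypotheses at the chosen bed (`ω ≤ 1`, net ω-weighted deficit `≤ 0`), demanded ONLY on the content locus
    (hWC : ∀ P : NFPoint, P ∈ UP → ∀ l : ℕ, l.Prime → 5 ≤ l →
      Cor22.AdmitsCore P → Cor22.CondP2 P l → Cor22.CondP5 P l → Cor22.CondP6 P l →
      6 * ((1 + 20 * (Cor22.dmod P : ℝ) / l) * (P.logDiff + Cor22.logCondAvoid P {2, l}))
          + 120 * (2 ^ 12 * 3 ^ 3 * 5 * (Cor22.dmod P : ℝ) * l) < Cor22.logQAvoid P {2, l} →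
      ∀ T : Cor22.ThetaVolumeDatumAt P l, letI := T.instFieldF; letI := T.instNumberFieldF; letI := T.instAlgebraF; letI := T.instFieldK;
        letI := T.instNumberFieldK; letI := T.instAlgebraK; letI := T.instFieldFbar; letI := T.instAlgebraFbar;
        letI := T.instAlgebraKFbar; letI := T.instIsElliptic;
      (∀ c : Fin (thetaIndex (pilotDataOfK T.D T.K)).lstar × (thetaIndex (pilotDataOfK T.D T.K)).VQ, ω P l T c ≤ 1) ∧
        weightedDeficit
          (settingPrVolSharp (pilotDataOfK T.D T.K) (logvAnalytic_analyticLogv (F := T.K)) (M P l T) (archPk P l T) (archSub P l T) (Ψ P l T)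
            (act P l T) (Mmod P l T) (region P l T) (n P l T) (lat P l T) (sig P l T) (split P l T) (qData P l T)
            (exists_realising_qIdeles_pilotDataOfK T.D).choose
            (exists_realising_thetaIdeles_pilotDataOfK T.D).choose
            (exists_realising_qIdeles_pilotDataOfK T.D).choose_spec.1
            (exists_realising_qIdeles_pilotDataOfK T.D).choose_spec.2.1) (ω P l T) ≤ 0)
    -- [MU-ω-C, KEPT FORM] the KEPT ω-mass is at least `μ₀·T.gap − Tol(P,l)`, demanded ONLY there
    (hKeptC : ∀ P : NFPoint, P ∈ UP → ∀ l : ℕ, l.Prime → 5 ≤ l →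
      Cor22.AdmitsCore P → Cor22.CondP2 P l → Cor22.CondP5 P l → Cor22.CondP6 P l →
      6 * ((1 + 20 * (Cor22.dmod P : ℝ) / l) * (P.logDiff + Cor22.logCondAvoid P {2, l}))
          + 120 * (2 ^ 12 * 3 ^ 3 * 5 * (Cor22.dmod P : ℝ) * l) < Cor22.logQAvoid P {2, l} →
      ∀ T : Cor22.ThetaVolumeDatumAt P l, letI := T.instFieldF; letI := T.instNumberFieldF; letI := T.instAlgebraF; letI := T.instFieldK;
        letI := T.instNumberFieldK; letI := T.instAlgebraK; letI := T.instFieldFbar; letI := T.instAlgebraFbar;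
        letI := T.instAlgebraKFbar; letI := T.instIsElliptic;
      μ₀ * T.gap - Conditional.SigmaMass.tol P l ≤
        weightedTrivialMass
          (settingPrVolSharp (pilotDataOfK T.D T.K) (logvAnalytic_analyticLogv (F := T.K)) (M P l T) (archPk P l T) (archSub P l T) (Ψ P l T)
            (act P l T) (Mmod P l T) (region P l T) (n P l T) (lat P l T) (sig P l T) (split P l T) (qData P l T)
            (exists_realising_qIdeles_pilotDataOfK T.D).choose
            (exists_realising_thetaIdeles_pilotDataOfK T.D).choose
            (exists_realising_qIdeles_pilotDataOfK T.D).choose_spec.1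
            (exists_realising_qIdeles_pilotDataOfK T.D).choose_spec.2.1) (fun c => 1 - ω P l T c))
    -- [CONE-C] abc-iut-C-cert-1's `hregC` VERBATIM (the off-regime hull estimate with print's `B_III(P,l)`, ONLY on the content locus)
    (hregC : ∀ P : NFPoint, P ∈ UP → ∀ l : ℕ, l.Prime → 5 ≤ l →
      Cor22.AdmitsCore P → Cor22.CondP2 P l → Cor22.CondP5 P l → Cor22.CondP6 P l →
      6 * ((1 + 20 * (Cor22.dmod P : ℝ) / l) * (P.logDiff + Cor22.logCondAvoid P {2, l}))
          + 120 * (2 ^ 12 * 3 ^ 3 * 5 * (Cor22.dmod P : ℝ) * l) < Cor22.logQAvoid P {2, l} →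
      ∀ T : Cor22.ThetaVolumeDatumAt P l,
        (letI := T.instFieldF; letI := T.instNumberFieldF; letI := T.instAlgebraF; letI := T.instFieldK
         letI := T.instNumberFieldK; letI := T.instAlgebraK; letI := T.instFieldFbar; letI := T.instAlgebraFbar
         letI := T.instAlgebraKFbar; letI := T.instIsElliptic
         ¬ (∀ p ∈ T.I.supportPrimes, ∀ v w : placesOver (fieldOfModuli T.E) p,
            (Summit.ABC.IUTFork.DHData.ofInput T.I).logQloc p v = (Summit.ABC.IUTFork.DHData.ofInput T.I).logQloc p w)) →
        T.HullEstimateOf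
          (((l : ℝ) + 1) / 4 *
            ((1 + 12 * (Cor22.dmod P : ℝ) / l) * (P.logDiff + Cor22.logCondAvoid P {2, l})
              + 2 * Real.log l + 52
              + 20 / 3 * Real.log (((2 ^ 12 * 3 ^ 3 * 5 * Cor22.dmod P : ℕ) : ℝ) * (l : ℝ))
                * (Nat.primeCounting (2 ^ 12 * 3 ^ 3 * 5 * Cor22.dmod P * l) : ℝ))))
    {ε' : ℝ} (hε' : 0 < ε') :
    ∃ C : ℝ, 0 < C ∧ ∀ a b c : ℕ, IsABCTriple a b c → (c : ℝ) < C * ((rad a b c : ℕ) : ℝ) ^ (3 / μ₀ + ε') :=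
  Cor312Slack.abc_exp_three_div_of_cor312Slack_mu_content_hregC μ₀ hμ₀ hμ₁
    (fun P l T => letI := T.instFieldF; letI := T.instNumberFieldF; letI := T.instAlgebraF; letI := T.instFieldK;
        letI := T.instNumberFieldK; letI := T.instAlgebraK; letI := T.instFieldFbar; letI := T.instAlgebraFbar;
        letI := T.instAlgebraKFbar; letI := T.instIsElliptic;
      weightedTrivialMass
        (settingPrVolSharp (pilotDataOfK T.D T.K) (logvAnalytic_analyticLogv (F := T.K)) (M P l T) (archPk P l T) (archSub P l T) (Ψ P l T)
            (act P l T) (Mmod P l T) (region P l T) (n P l T) (lat P l T) (sig P l T) (split P l T) (qData P l T)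
            (exists_realising_qIdeles_pilotDataOfK T.D).choose
            (exists_realising_thetaIdeles_pilotDataOfK T.D).choose
            (exists_realising_qIdeles_pilotDataOfK T.D).choose_spec.1
            (exists_realising_qIdeles_pilotDataOfK T.D).choose_spec.2.1) (ω P l T))
    (fun P hP l hl h5 hcore hP2 hP5 hP6 hct T =>
      cor312UpTo_weightedTrivialMass_of_weightedDeficit_nonpos_chosen T (M P l T) (archPk P l T) (archSub P l T) (Ψ P l T) (act P l T) (Mmod P l T)
        (region P l T) (n P l T) (lat P l T) (sig P l T) (split P l T) (qData P l T) (ω P l T)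
        (hWC P hP l hl h5 hcore hP2 hP5 hP6 hct T).1 (hWC P hP l hl h5 hcore hP2 hP5 hP6 hct T).2)
    (fun P hP l hl h5 hcore hP2 hP5 hP6 hct T =>
      (offSigmaTolerance_weightedTrivialMass_iff_keptMass_ge_chosen T (M P l T) (archPk P l T) (archSub P l T) (Ψ P l T) (act P l T) (Mmod P l T)
        (region P l T) (n P l T) (lat P l T) (sig P l T) (split P l T) (qData P l T) (ω P l T) μ₀ (Conditional.SigmaMass.tol P l)).2
        (hKeptC P hP l hl h5 hcore hP2 hP5 hP6 hct T))
    hregC hε'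

/-- **`ABCExpOn_farFromCusps_of_weightedDeficit_nonpos_keptMass_content_hregC_degOne` — THE WEIGHTED (NETTED) DOOR ⟹ abc WITH EXPONENT `1/μ₀` ON EVERY
FAR-FROM-CUSPS FAMILY** (`0 < μ₀ ≤ 1`) = D0121-SPEC §1.2 topt-pv-3's sentence with `μ_fin ↦ μ₀` free: [W-C] · [KEPT-C] · [CONE-C] on the content locus ⟹ for
every `0 < ρ ≤ 1/2`, `GenEll.ABCWithExponentOn {P | P.FarFromCusps {2} ρ} (1/μ₀)`; q2-cond's `Cor312Slack.ABCExpOn_farFromCusps_of_cor312Slack_mu_content_hregC_degOne`,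
[NUMΣ-C] DISCHARGED, [MU-C] from [KEPT-C] by §1. CONDITIONAL; no side taken. [cite: Mochizuki2012, IUTchIV Thm. 1.10 pp. 22–31; Cor. 2.2 (ii)–(iii) pp. 41–48]
[cite: MochizukiGenEll2010, Thm 2.1 p.12] [claim: Mochizuki2012, status: disputed] -/
theorem ABCExpOn_farFromCusps_of_weightedDeficit_nonpos_keptMass_content_hregC_degOne (μ₀ : ℝ) (hμ₀ : 0 < μ₀) (hμ₁ : μ₀ ≤ 1)
    (ω : ∀ (P : NFPoint) (l : ℕ) (T : Cor22.ThetaVolumeDatumAt P l), letI := T.instFieldF; letI := T.instNumberFieldF; letI := T.instAlgebraF; letI := T.instFieldK;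
        letI := T.instNumberFieldK; letI := T.instAlgebraK; letI := T.instFieldFbar; letI := T.instAlgebraFbar;
        letI := T.instAlgebraKFbar; letI := T.instIsElliptic;
      Fin (thetaIndex (pilotDataOfK T.D T.K)).lstar × (thetaIndex (pilotDataOfK T.D T.K)).VQ → ℝ)
    -- [W-C] THE WEIGHTED DOOR's hypotheses at the chosen bed (`ω ≤ 1`, net ω-weighted deficit `≤ 0`), demanded ONLY on the content locus
    (hWC : ∀ P : NFPoint, P ∈ UP → ∀ l : ℕ, l.Prime → 5 ≤ l →
      Cor22.AdmitsCore P → Cor22.CondP2 P l → Cor22.CondP5 P l → Cor22.CondP6 P l →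
      6 * ((1 + 20 * (Cor22.dmod P : ℝ) / l) * (P.logDiff + Cor22.logCondAvoid P {2, l}))
          + 120 * (2 ^ 12 * 3 ^ 3 * 5 * (Cor22.dmod P : ℝ) * l) < Cor22.logQAvoid P {2, l} →
      ∀ T : Cor22.ThetaVolumeDatumAt P l, letI := T.instFieldF; letI := T.instNumberFieldF; letI := T.instAlgebraF; letI := T.instFieldK;
        letI := T.instNumberFieldK; letI := T.instAlgebraK; letI := T.instFieldFbar; letI := T.instAlgebraFbar;
        letI := T.instAlgebraKFbar; letI := T.instIsElliptic;
      (∀ c : Fin (thetaIndex (pilotDataOfK T.D T.K)).lstar × (thetaIndex (pilotDataOfK T.D T.K)).VQ, ω P l T c ≤ 1) ∧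
        weightedDeficit
          (settingPrVolSharp (pilotDataOfK T.D T.K) (logvAnalytic_analyticLogv (F := T.K)) (M P l T) (archPk P l T) (archSub P l T) (Ψ P l T)
            (act P l T) (Mmod P l T) (region P l T) (n P l T) (lat P l T) (sig P l T) (split P l T) (qData P l T)
            (exists_realising_qIdeles_pilotDataOfK T.D).choose
            (exists_realising_thetaIdeles_pilotDataOfK T.D).choose
            (exists_realising_qIdeles_pilotDataOfK T.D).choose_spec.1
            (exists_realising_qIdeles_pilotDataOfK T.D).choose_spec.2.1) (ω P l T) ≤ 0)
    -- [MU-ω-C, KEPT FORM] the KEPT ω-mass is at least `μ₀·T.gap − Tol(P,l)`, demanded ONLY there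
    (hKeptC : ∀ P : NFPoint, P ∈ UP → ∀ l : ℕ, l.Prime → 5 ≤ l →
      Cor22.AdmitsCore P → Cor22.CondP2 P l → Cor22.CondP5 P l → Cor22.CondP6 P l →
      6 * ((1 + 20 * (Cor22.dmod P : ℝ) / l) * (P.logDiff + Cor22.logCondAvoid P {2, l}))
          + 120 * (2 ^ 12 * 3 ^ 3 * 5 * (Cor22.dmod P : ℝ) * l) < Cor22.logQAvoid P {2, l} →
      ∀ T : Cor22.ThetaVolumeDatumAt P l, letI := T.instFieldF; letI := T.instNumberFieldF; letI := T.instAlgebraF; letI := T.instFieldK;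
        letI := T.instNumberFieldK; letI := T.instAlgebraK; letI := T.instFieldFbar; letI := T.instAlgebraFbar;
        letI := T.instAlgebraKFbar; letI := T.instIsElliptic;
      μ₀ * T.gap - Conditional.SigmaMass.tol P l ≤
        weightedTrivialMass
          (settingPrVolSharp (pilotDataOfK T.D T.K) (logvAnalytic_analyticLogv (F := T.K)) (M P l T) (archPk P l T) (archSub P l T) (Ψ P l T)
            (act P l T) (Mmod P l T) (region P l T) (n P l T) (lat P l T) (sig P l T) (split P l T) (qData P l T)
            (exists_realising_qIdeles_pilotDataOfK T.D).choose
            (exists_realising_thetaIdeles_pilotDataOfK T.D).choose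
            (exists_realising_qIdeles_pilotDataOfK T.D).choose_spec.1
            (exists_realising_qIdeles_pilotDataOfK T.D).choose_spec.2.1) (fun c => 1 - ω P l T c))
    -- [CONE-C] abc-iut-C-cert-1's `hregC` VERBATIM (the off-regime hull estimate with print's `B_III(P,l)`, ONLY on the content locus)
    (hregC : ∀ P : NFPoint, P ∈ UP → ∀ l : ℕ, l.Prime → 5 ≤ l →
      Cor22.AdmitsCore P → Cor22.CondP2 P l → Cor22.CondP5 P l → Cor22.CondP6 P l →
      6 * ((1 + 20 * (Cor22.dmod P : ℝ) / l) * (P.logDiff + Cor22.logCondAvoid P {2, l}))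
          + 120 * (2 ^ 12 * 3 ^ 3 * 5 * (Cor22.dmod P : ℝ) * l) < Cor22.logQAvoid P {2, l} →
      ∀ T : Cor22.ThetaVolumeDatumAt P l,
        (letI := T.instFieldF; letI := T.instNumberFieldF; letI := T.instAlgebraF; letI := T.instFieldK
         letI := T.instNumberFieldK; letI := T.instAlgebraK; letI := T.instFieldFbar; letI := T.instAlgebraFbar
         letI := T.instAlgebraKFbar; letI := T.instIsElliptic
         ¬ (∀ p ∈ T.I.supportPrimes, ∀ v w : placesOver (fieldOfModuli T.E) p,
            (Summit.ABC.IUTFork.DHData.ofInput T.I).logQloc p v = (Summit.ABC.IUTFork.DHData.ofInput T.I).logQloc p w)) →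
        T.HullEstimateOf
          (((l : ℝ) + 1) / 4 *
            ((1 + 12 * (Cor22.dmod P : ℝ) / l) * (P.logDiff + Cor22.logCondAvoid P {2, l})
              + 2 * Real.log l + 52
              + 20 / 3 * Real.log (((2 ^ 12 * 3 ^ 3 * 5 * Cor22.dmod P : ℕ) : ℝ) * (l : ℝ))
                * (Nat.primeCounting (2 ^ 12 * 3 ^ 3 * 5 * Cor22.dmod P * l) : ℝ))))
    {ρ : ℝ} (h0 : 0 < ρ) (h2 : ρ ≤ 1 / 2) :
    ABCWithExponentOn {P : NFPoint | P.FarFromCusps ({2} : Finset ℕ) ρ} (1 / μ₀) :=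
  Cor312Slack.ABCExpOn_farFromCusps_of_cor312Slack_mu_content_hregC_degOne μ₀ hμ₀ hμ₁
    (fun P l T => letI := T.instFieldF; letI := T.instNumberFieldF; letI := T.instAlgebraF; letI := T.instFieldK;
        letI := T.instNumberFieldK; letI := T.instAlgebraK; letI := T.instFieldFbar; letI := T.instAlgebraFbar;
        letI := T.instAlgebraKFbar; letI := T.instIsElliptic;
      weightedTrivialMass
        (settingPrVolSharp (pilotDataOfK T.D T.K) (logvAnalytic_analyticLogv (F := T.K)) (M P l T) (archPk P l T) (archSub P l T) (Ψ P l T)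
            (act P l T) (Mmod P l T) (region P l T) (n P l T) (lat P l T) (sig P l T) (split P l T) (qData P l T)
            (exists_realising_qIdeles_pilotDataOfK T.D).choose
            (exists_realising_thetaIdeles_pilotDataOfK T.D).choose
            (exists_realising_qIdeles_pilotDataOfK T.D).choose_spec.1
            (exists_realising_qIdeles_pilotDataOfK T.D).choose_spec.2.1) (ω P l T))
    (fun P hP l hl h5 hcore hP2 hP5 hP6 hct T =>
      cor312UpTo_weightedTrivialMass_of_weightedDeficit_nonpos_chosen T (M P l T) (archPk P l T) (archSub P l T) (Ψ P l T) (act P l T) (Mmod P l T)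
        (region P l T) (n P l T) (lat P l T) (sig P l T) (split P l T) (qData P l T) (ω P l T)
        (hWC P hP l hl h5 hcore hP2 hP5 hP6 hct T).1 (hWC P hP l hl h5 hcore hP2 hP5 hP6 hct T).2)
    (fun P hP l hl h5 hcore hP2 hP5 hP6 hct T =>
      (offSigmaTolerance_weightedTrivialMass_iff_keptMass_ge_chosen T (M P l T) (archPk P l T) (archSub P l T) (Ψ P l T) (act P l T) (Mmod P l T)
        (region P l T) (n P l T) (lat P l T) (sig P l T) (split P l T) (qData P l T) (ω P l T) μ₀ (Conditional.SigmaMass.tol P l)).2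
        (hKeptC P hP l hl h5 hcore hP2 hP5 hP6 hct T))
    hregC h0 h2

end Ends

end Summit.ABC.IUTFork.Repair.RH.SigmaStrataEq
end
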